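import Summits.ValiantsHypothesis.ValiantsHypothesis.Theorems.OrderedCountWindowBalancing
import Summits.ValiantsHypothesis.ValiantsHypothesis.Theorems.NisanDeterminant
import HarnessLib

/-!
# The ordered-count window for the DETERMINANT: `det_N` obeys the reservoir bound verbatim (kernel)

Decomposition workshop `decomp-valiant`, lens 6 «restricted-models lifting axis», gen 8 — the DET TWIN
of `OrderedCountWindowReservoir` / `…Balancing`.  PLACEMENT DATUM (LESSON 6), not a route item: the
support-size axis `A_t` («`per_n` is not a sum of `t n` ordered set-multilinear ABPs of polynomial total
width») is decided for EVERY `t` by the alphabet-2 pair reservoir (`perNotSumOrdered_all'`), and this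
file records in the kernel that the SAME bound with the SAME proof holds for the determinant:

* `IsSumOrderedW F n t W ω` — sums of `t` ordered programs of total width `≤ W` for an ARBITRARY word
  tensor `ω` (`ω = perWord`: the tree's `IsSumOrdered`, `isSumOrderedW_perWord_iff`; `ω = detWord`:
  `IsSumOrderedDet`);
* `two_pow_le_pow_of_isSumOrderedW` — the finite reservoir inequality
  `2^{⌊q⌊√r/32⌋/4⌋} ≤ W^{q+1}` for every word tensor SUPPORTED EXACTLY ON THE PERMUTATION WORDS
  (`ω w = 0` off permutations, `ω w ≠ 0` on them): the pair restriction of such a tensor has a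
  flattening that is a unit diagonal matrix times a permutation matrix (`rank_setFlattening_of_support`);
* `two_pow_le_pow_of_isSumOrderedDet`, **`detNotSumOrdered_all (t) : DetNotSumOrdered t`** — the det
  instances (`detWord = sign` on permutations, `0` elsewhere).

CONSEQUENCE FOR THE ROUTE (`DecompCycle1`, cruxes `PerNotSmVP` / `TameOrSmLift`): the ordered-count
window is a regime in which `per` and `det` behave IDENTICALLY, so nothing on this axis can be a binder
of `closes`; it is context for the barrier placement (min-partition-rank class, [cite:
FournierLimayeSrinivasanYehudayoff2026Barrier, Cor 1.3]) and is now exhausted as a source of rungs.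

HONEST FRAMING: Chatterjee–Kush–Saraf–Shpilka's method (CCC 2024, Claim 1, Lemma 4) run on a
restriction of `det_N` instead of their `G_{n,d}`; Arvind–Raja 2016 §7 asked the question for PER and
noted the rank method is sign-blind.  Nothing here bears on `VP ≠ VNP`.

## References
* [ChatterjeeKushSarafShpilka2024] Chatterjee–Kush–Saraf–Shpilka, CCC 2024 (arXiv:2312.15874), Claim 1,
  Lemma 4, Thm 3. [ArvindRaja2016] Arvind–Raja, Chicago J. TCS 2016, Thm 7, Cor 12, §7.
  [Nisan1991Noncommutative] Nisan, STOC 1991, §4.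
-/

noncomputable section

namespace Summit.ValiantsHypothesis.ValiantsHypothesis.Theorems.OrderedCountWindow

open Literature.Computability.AlgebraicComplexity Matrix
open Summit.ValiantsHypothesis.ValiantsHypothesis.Theorems.NisanDeterminant

variable {F : Type*} [Field F]

/-! ## §1 Sums of ordered programs for an arbitrary word tensor -/

/-- **The word tensor `ω` is a sum of `t` ORDERED set-multilinear ABPs of total width `≤ W`**: block
orders `σ i`, widths `w i` (`∑ w i ≤ W`) and coefficient tensors of nc-ABP width `≤ w i` adding up to
`ω` (the tree's `IsSumOrdered` is the case `ω = perWord`). [cite: ArvindRaja2016, §3, Thm 7] -/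
def IsSumOrderedW (F : Type*) [Field F] (n t W : ℕ) (ω : (Fin n → Fin n) → F) : Prop :=
  ∃ (σ : Fin t → Equiv.Perm (Fin n)) (w : Fin t → ℕ) (B : Fin t → (Fin n → Fin n) → F),
    (∀ i, BDI2020.HasNcABPWidthLE (w i) (B i)) ∧ ∑ i, w i ≤ W ∧
      ∀ J : Fin n → Fin n, ∑ i, B i (J ∘ ⇑(σ i)) = ω J

/-- The permanent case is the tree's `IsSumOrdered`, by definition. [folklore] -/
theorem isSumOrderedW_perWord_iff {n t W : ℕ} :
    IsSumOrderedW F n t W (NisanPermanent.perWord F n) ↔ IsSumOrdered F n t W := Iff.rfl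

/-- **`det_n` (ordered/Cayley word tensor `detWord = sign · [permutation]`) is a sum of `t` ordered
set-multilinear ABPs of total width `≤ W`.** [cite: Nisan1991Noncommutative, §4; ArvindRaja2016, §7] -/
def IsSumOrderedDet (F : Type*) [Field F] (n t W : ℕ) : Prop :=
  IsSumOrderedW F n t W (detWord F n)

/-- The det dial: for every exponent `c`, some `det_n` is NOT a sum of `t n` ordered set-multilinear
ABPs of total width `≤ n ^ c + c` (the twin of `PerNotSumOrdered t`). [cite: ArvindRaja2016, §7] -/
def DetNotSumOrdered (t : ℕ → ℕ) : Prop :=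
  ∀ c : ℕ, ∃ n : ℕ, ¬ IsSumOrderedDet ℂ n (t n) (n ^ c + c)

variable {N d n : ℕ}

/-- The projected tensor of a block-respecting substitution `(γ, ρ, B)` applied to the word tensor `ω`:
`T(j) = ∑_J ω J · ∏_c M_j (J c) c`. [cite: ArvindRaja2016, §3; Nisan1991Noncommutative, §4] -/
def transferTensorW (ω : (Fin N → Fin N) → F) (γ : Fin N → Option (Fin d))
    (ρ : Fin d → Fin n → Fin N) (B : Fin N → Fin N → F) (j : Fin d → Fin n) : F :=
  ∑ J : Fin N → Fin N, ω J * ∏ c, substMatrix γ ρ B j (J c) c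

/-- **Uniform transfer for a word tensor** (verbatim the permanent's `transfer_uniform`): block orders
and widths such that EVERY block-respecting substitution of `ω` is the sum of `t` layer-local programs,
program `i` of width `w i` reading block `γ (σ i p)` at layer `p`.
[cite: ChatterjeeKushSarafShpilka2024, §1.2; ArvindRaja2016, §3] -/
theorem transfer_uniformW {t W : ℕ} {ω : (Fin N → Fin N) → F} (h : IsSumOrderedW F N t W ω) :
    ∃ (σ : Fin t → Equiv.Perm (Fin N)) (w : Fin t → ℕ), ∑ i, w i ≤ W ∧
      ∀ (d n : ℕ) (γ : Fin N → Option (Fin d)) (ρ : Fin d → Fin n → Fin N) (B : Fin N → Fin N → F),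
        ∃ B' : Fin t → (Fin d → Fin n) → F,
          (∀ i, HasOsmWidthLE (w i) (fun p => γ (σ i p)) (B' i)) ∧
            ∀ j, ∑ i, B' i j = transferTensorW ω γ ρ B j := by
  classical
  obtain ⟨σ, w, Bt, hBt, hsum, hω⟩ := h
  choose C u v hC using hBt
  refine ⟨σ, w, hsum, fun d n γ ρ B => ⟨fun i j => u i ⬝ᵥ
      ((List.ofFn fun p => ∑ r, substMatrix γ ρ B j r (σ i p) • C i p r).prod *ᵥ v i),
    fun i => ?_, fun j => ?_⟩⟩
  · -- each summand is a layer-local program of the same width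
    refine ⟨fun p j => ∑ r, substMatrix γ ρ B j r (σ i p) • C i p r, u i, v i,
      fun p j j' hjj' => ?_, fun j => rfl⟩
    exact Finset.sum_congr rfl fun r _ => by rw [substMatrix_congr γ ρ B hjj']
  · -- the identity `∑_i (substituted program i) = T`
    have key : ∀ i, u i ⬝ᵥ ((List.ofFn fun p =>
        ∑ r, substMatrix γ ρ B j r (σ i p) • C i p r).prod *ᵥ v i) =
        ∑ J : Fin N → Fin N, Bt i (J ∘ ⇑(σ i)) * ∏ c, substMatrix γ ρ B j (J c) c := by
      intro i
      have h1 : ∑ J : Fin N → Fin N, Bt i (J ∘ ⇑(σ i)) * ∏ c, substMatrix γ ρ B j (J c) c =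
          ∑ J' : Fin N → Fin N, Bt i J' * ∏ p, substMatrix γ ρ B j (J' p) (σ i p) := by
        refine Fintype.sum_equiv ((σ i).symm.arrowCongr (Equiv.refl (Fin N))) _ _ fun J => ?_
        have hJ : ((σ i).symm.arrowCongr (Equiv.refl (Fin N))) J = J ∘ ⇑(σ i) := by
          ext p; simp
        rw [hJ, ← Equiv.prod_comp (σ i) (fun c => substMatrix γ ρ B j (J c) c)]
        rfl
      have h2 : ∀ J' : Fin N → Fin N, Bt i J' * ∏ p, substMatrix γ ρ B j (J' p) (σ i p) =
          u i ⬝ᵥ ((List.ofFn fun p => substMatrix γ ρ B j (J' p) (σ i p) • C i p (J' p)).prod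
            *ᵥ v i) := by
        intro J'
        rw [hC i J', listProd_ofFn_smul (fun p => substMatrix γ ρ B j (J' p) (σ i p))
          (fun p => C i p (J' p)), Matrix.smul_mulVec, dotProduct_smul, smul_eq_mul, mul_comm]
      rw [h1, listProd_ofFn_sum (fun p r => substMatrix γ ρ B j r (σ i p) • C i p r),
        Matrix.sum_mulVec, dotProduct_sum]
      exact Finset.sum_congr rfl fun J' _ => (h2 J').symm
    simp only [key, transferTensorW]
    rw [Finset.sum_comm]
    refine Finset.sum_congr rfl fun J _ => ?_
    rw [← Finset.sum_mul, hω J]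

/-- With every column variable (`γ = some`), the projected tensor at `j` is `ω` at the row word
`c ↦ ρ c (j c)`. [cite: Nisan1991Noncommutative, §4] -/
theorem transferTensorW_some (ω : (Fin N → Fin N) → F) (ρ : Fin N → Fin n → Fin N)
    (B : Fin N → Fin N → F) (j : Fin N → Fin n) :
    transferTensorW ω (fun c : Fin N => some c) ρ B j = ω (fun c => ρ c (j c)) := by
  classical
  unfold transferTensorW substMatrix
  simp only [Option.elim_some, Fintype.prod_boole]
  have hiff : ∀ J : Fin N → Fin N, (∀ c, J c = ρ c (j c)) ↔ J = fun c => ρ c (j c) :=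
    fun J => funext_iff.symm
  simp_rw [hiff]
  simp

/-! ## §2 The pair restriction of a word tensor supported on the permutation words -/

section Pair

variable (S : Finset (Fin N)) (e : {c // c ∈ S} ≃ {c // c ∉ S})

/-- **Pair restriction of a `ΣosmABP` for `ω`**: block orders and widths such that for EVERY matching
`(S, e)` the restricted tensor `j ↦ ω (c ↦ pairRow c (j c))` is the sum of `t` layer-local ordered
programs of the same widths. [cite: ChatterjeeKushSarafShpilka2024, §1.2; ArvindRaja2016, §3] -/
theorem pair_restrictionW {t W : ℕ} {ω : (Fin N → Fin N) → F} (h : IsSumOrderedW F N t W ω) :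
    ∃ (σ : Fin t → Equiv.Perm (Fin N)) (w : Fin t → ℕ), ∑ i, w i ≤ W ∧
      ∀ (S : Finset (Fin N)) (e : {c // c ∈ S} ≃ {c // c ∉ S}),
        ∃ B' : Fin t → (Fin N → Fin 2) → F,
          (∀ i, HasOsmWidthLE (w i) (fun p => some (σ i p)) (B' i)) ∧
            ∀ j, ∑ i, B' i j = ω (fun c => pairRow S e c (j c)) := by
  obtain ⟨σ, w, hsum, hall⟩ := transfer_uniformW h
  refine ⟨σ, w, hsum, fun S e => ?_⟩
  obtain ⟨B', hB', hT⟩ := hall N 2 (fun c => some c) (pairRow S e) (fun _ _ => 0)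
  exact ⟨B', hB', fun j => by rw [hT j, transferTensorW_some]⟩

/-- The row word of the pair substitution is a PERMUTATION iff the letters of every matched pair agree
(read off the permanent case `perWord_pairRow`). [cite: ArvindRaja2016, Thm 7 (the test words)] -/
theorem injective_pairRow_iff (j : Fin N → Fin 2) :
    Function.Injective (fun c => pairRow S e c (j c)) ↔ ∀ s : {c // c ∈ S}, j s.1 = j (e s).1 := by
  classical
  have h := perWord_pairRow (F := ℚ) S e j
  simp only [NisanPermanent.perWord, pairTensor] at h
  by_cases ha : ∀ s : {c // c ∈ S}, j s.1 = j (e s).1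
  · rw [if_pos ha] at h
    by_cases hi : Function.Injective (fun c => pairRow S e c (j c))
    · exact iff_of_true hi ha
    · rw [if_neg hi] at h
      exact absurd h zero_ne_one
  · rw [if_neg ha] at h
    by_cases hi : Function.Injective (fun c => pairRow S e c (j c))
    · rw [if_pos hi] at h
      exact absurd h one_ne_zero
    · exact iff_of_false hi ha

/-- **A tensor supported EXACTLY on the agreeing words has a full-rank flattening across `S`**: the
flattening is `diag(units) · (permutation matrix x ↦ x ∘ e⁻¹)`, rank `2^|Sᶜ|` — the sign-blindness of
the rank method. [cite: ChatterjeeKushSarafShpilka2024, Claim 1; Nisan1991Noncommutative, §4 (det)] -/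
theorem rank_setFlattening_of_support (D : (Fin N → Fin 2) → F)
    (h0 : ∀ j, (¬ ∀ s : {c // c ∈ S}, j s.1 = j (e s).1) → D j = 0)
    (h1 : ∀ j, (∀ s : {c // c ∈ S}, j s.1 = j (e s).1) → D j ≠ 0) :
    (setFlattening S D).rank = 2 ^ (Fintype.card {c // c ∉ S}) := by
  classical
  -- the bijection rows → columns: `x ↦ x ∘ e.symm`
  let f : ({c // c ∈ S} → Fin 2) ≃ ({c // c ∉ S} → Fin 2) := e.arrowCongr (Equiv.refl _)
  have hf : ∀ x y, (∀ s : {c // c ∈ S}, glueWord S x y s.1 = glueWord S x y (e s).1) ↔ f x = y := by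
    intro x y
    have hg1 : ∀ s : {c // c ∈ S}, glueWord S x y s.1 = x s := fun s =>
      glueWord_of_mem S x y s.2
    have hg2 : ∀ s : {c // c ∈ S}, glueWord S x y (e s).1 = y (e s) := fun s =>
      glueWord_of_not_mem S x y (e s).2
    simp only [hg1, hg2]
    constructor
    · intro h
      funext c'
      have := h (e.symm c')
      simp only [Equiv.apply_symm_apply] at this
      simpa [f] using this
    · rintro rfl s
      simp [f]
  -- the diagonal of units
  let dcol : ({c // c ∉ S} → Fin 2) → F := fun y => D (glueWord S (f.symm y) y)
  have hM : setFlattening S D = (Matrix.diagonal dcol).submatrix f id := by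
    ext x y
    simp only [setFlattening_apply, Matrix.submatrix_apply, Matrix.diagonal_apply, id_eq]
    by_cases hxy : f x = y
    · rw [if_pos hxy]
      subst hxy
      simp only [dcol, Equiv.symm_apply_apply]
    · rw [if_neg hxy]
      exact h0 _ (mt (hf x y).1 hxy)
  have hunit : IsUnit (Matrix.diagonal dcol) := by
    rw [Matrix.isUnit_diagonal, Pi.isUnit_iff]
    intro y
    exact isUnit_iff_ne_zero.mpr (h1 _ ((hf _ y).2 (Equiv.apply_symm_apply f y)))
  rw [hM, show (Matrix.diagonal dcol).submatrix ⇑f id =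
      (Matrix.diagonal dcol).submatrix ⇑f ⇑(Equiv.refl _) from rfl, Matrix.rank_submatrix,
    Matrix.rank_of_isUnit _ hunit, Fintype.card_fun, Fintype.card_fin]

end Pair

/-! ## §3 The reservoir inequality for every word tensor supported on the permutation words -/

/-- **Finite reservoir inequality, sign-blind form.** If a word tensor `ω` on `N = 2P = q·r` columns
(`r ≥ 1024`) vanishing off the permutation words and non-vanishing on them is a sum of ordered
set-multilinear ABPs of total width `≤ W` with `W (2P+1) < 2^q`, then `2^{⌊q⌊√r/32⌋/4⌋} ≤ W^{q+1}`
(proof = the permanent's, `two_pow_le_pow_of_isSumOrdered`, with `rank_setFlattening_of_support` for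
`rank_setFlattening_pairTensor` and the PROVED `balancedSegments`).
[cite: ChatterjeeKushSarafShpilka2024, Lemma 4, Claim 1; ArvindRaja2016, §7] -/
theorem two_pow_le_pow_of_isSumOrderedW {P q r t W : ℕ} {ω : (Fin (P + P) → Fin (P + P)) → F}
    (hω0 : ∀ w, ¬ Function.Injective w → ω w = 0) (hω1 : ∀ w, Function.Injective w → ω w ≠ 0)
    (hN : P + P = q * r) (hr : 1024 ≤ r) (hW : W * (P + P + 1) < 2 ^ q)
    (h : IsSumOrderedW F (P + P) t W ω) : 2 ^ (q * (Nat.sqrt r / 32) / 4) ≤ W ^ (q + 1) := by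
  classical
  obtain ⟨σ, w, hsum, hall⟩ := pair_restrictionW h
  have hwW : ∀ i, w i ≤ W := fun i =>
    (Finset.single_le_sum (fun i _ => Nat.zero_le (w i)) (Finset.mem_univ i)).trans hsum
  -- the positive-width programs
  let ι := {i : Fin t // 0 < w i}
  have hι : Fintype.card ι ≤ W := by
    rw [Fintype.card_subtype]
    calc (Finset.univ.filter fun i => 0 < w i).card
        = ∑ i ∈ Finset.univ.filter (fun i => 0 < w i), 1 := by simp
      _ ≤ ∑ i ∈ Finset.univ.filter (fun i => 0 < w i), w i :=
          Finset.sum_le_sum fun i hi => (Finset.mem_filter.1 hi).2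
      _ ≤ ∑ i, w i := Finset.sum_le_sum_of_subset (Finset.filter_subset _ _)
      _ ≤ W := hsum
  have hι' : Fintype.card ι * (P + P + 1) < 2 ^ q :=
    lt_of_le_of_lt (Nat.mul_le_mul_right _ hι) hW
  -- their segments, balanced by the PROVED `balancedSegments`
  let τ : Fin t → Fin (q * r) → Fin (P + P) := fun i p => σ i (Fin.cast hN.symm p)
  have hτ : ∀ i, Function.Injective (τ i) := fun i =>
    (σ i).injective.comp (Fin.cast_injective _)
  let A : ι → Fin q → Finset (Fin (P + P)) := fun i m => segment (τ i.1) m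
  obtain ⟨S, hS, himb⟩ := balancedSegments ι P q r A hr hι' (fun i m => card_segment (hτ i.1) m)
    (fun i m m' hmm' => disjoint_segment (hτ i.1) hmm')
  -- the matching
  have hcS : Fintype.card {c // c ∈ S} = P := by rw [Fintype.card_coe, hS]
  have hcSc : Fintype.card {c // c ∉ S} = P := by
    rw [Fintype.card_subtype_compl, Fintype.card_fin, hcS]
    omega
  let e : {c // c ∈ S} ≃ {c // c ∉ S} := Fintype.equivOfCardEq (hcS.trans hcSc.symm)
  obtain ⟨B', hB', hT⟩ := hall S e
  -- the restricted tensor and its full-rank flattening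
  let D : (Fin (P + P) → Fin 2) → F := fun j => ω (fun c => pairRow S e c (j c))
  have hD : (setFlattening S D).rank = 2 ^ P := by
    rw [rank_setFlattening_of_support S e D
      (fun j hj => hω0 _ (mt (injective_pairRow_iff S e j).1 hj))
      (fun j hj => hω1 _ ((injective_pairRow_iff S e j).2 hj)), hcSc]
  have hflat : setFlattening S D = ∑ i, setFlattening S (B' i) := by
    rw [← setFlattening_sum]
    congr 1
    funext j
    exact (hT j).symm
  -- per-program bound
  set hh := q * (Nat.sqrt r / 32) / 4 with hhh
  have hprog : ∀ i, (setFlattening S (B' i)).rank * 2 ^ hh ≤ w i ^ (q + 1) * 2 ^ P := by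
    intro i
    rcases Nat.eq_zero_or_pos (w i) with h0 | hpos
    · have hz : B' i = fun _ => 0 := by
        have hB0 := hB' i
        rw [h0] at hB0
        exact eq_zero_of_hasOsmWidthLE_zero hB0
      rw [hz, setFlattening_zero, Matrix.rank_zero, zero_mul]
      exact Nat.zero_le _
    · have hprog' := rank_setFlattening_le_of_hasOsmWidthLE (n := 2) (τ i)
        (HasOsmWidthLE.castLayers hN (hB' i)) S
      have hbook : ∑ m : Fin q, min (segment (τ i) m ∩ S).card (segment (τ i) m \ S).card + hh
          ≤ P := by
        refine sum_min_add_le S (fun m => segment (τ i) m) ?_ (himb ⟨i, hpos⟩)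
        rw [Finset.sum_congr rfl fun m _ => card_segment (hτ i) m]
        simp [hN]
      calc (setFlattening S (B' i)).rank * 2 ^ hh
          ≤ (w i ^ (q + 1) * 2 ^ ∑ m : Fin q, min (segment (τ i) m ∩ S).card
              (segment (τ i) m \ S).card) * 2 ^ hh := Nat.mul_le_mul_right _ hprog'
        _ = w i ^ (q + 1) * 2 ^ (∑ m : Fin q, min (segment (τ i) m ∩ S).card
              (segment (τ i) m \ S).card + hh) := by rw [mul_assoc, ← pow_add]
        _ ≤ w i ^ (q + 1) * 2 ^ P :=
            Nat.mul_le_mul_left _ (Nat.pow_le_pow_right (by norm_num) hbook)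
  -- sum up
  have hmain : 2 ^ P * 2 ^ hh ≤ (∑ i, w i ^ (q + 1)) * 2 ^ P := by
    calc 2 ^ P * 2 ^ hh = (setFlattening S D).rank * 2 ^ hh := by rw [hD]
      _ ≤ (∑ i, (setFlattening S (B' i)).rank) * 2 ^ hh := by
            rw [hflat]
            exact Nat.mul_le_mul_right _ (rank_sum_le _ _)
      _ = ∑ i, (setFlattening S (B' i)).rank * 2 ^ hh := Finset.sum_mul _ _ _
      _ ≤ ∑ i, w i ^ (q + 1) * 2 ^ P := Finset.sum_le_sum fun i _ => hprog i
      _ = (∑ i, w i ^ (q + 1)) * 2 ^ P := (Finset.sum_mul _ _ _).symm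
  have hsumpow : ∑ i, w i ^ (q + 1) ≤ W ^ (q + 1) := by
    calc ∑ i, w i ^ (q + 1) = ∑ i, w i * w i ^ q := Finset.sum_congr rfl fun i _ => by ring
      _ ≤ ∑ i, w i * W ^ q := Finset.sum_le_sum fun i _ =>
          Nat.mul_le_mul_left _ (Nat.pow_le_pow_left (hwW i) q)
      _ = (∑ i, w i) * W ^ q := (Finset.sum_mul _ _ _).symm
      _ ≤ W * W ^ q := Nat.mul_le_mul_right _ hsum
      _ = W ^ (q + 1) := by ring
  have h2 : 2 ^ hh ≤ ∑ i, w i ^ (q + 1) := by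
    rw [mul_comm] at hmain
    exact Nat.le_of_mul_le_mul_right hmain (by positivity)
  exact h2.trans hsumpow

/-! ## §4 The determinant -/

/-- **The reservoir inequality for `det_{2P}`**: verbatim the permanent's bound
(`two_pow_le_pow_of_isSumOrdered'`). [cite: ChatterjeeKushSarafShpilka2024, Lemma 4, Claim 1;
Nisan1991Noncommutative, §4 (the rank method does not see signs)] -/
theorem two_pow_le_pow_of_isSumOrderedDet {P q r t W : ℕ} (hN : P + P = q * r) (hr : 1024 ≤ r)
    (hW : W * (P + P + 1) < 2 ^ q) (h : IsSumOrderedDet F (P + P) t W) :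
    2 ^ (q * (Nat.sqrt r / 32) / 4) ≤ W ^ (q + 1) :=
  two_pow_le_pow_of_isSumOrderedW
    (fun w hw => show wordSign F (P + P) w = 0 from wordSign_of_not_injective hw)
    (fun w hw => show wordSign F (P + P) w ≠ 0 from
      wordSign_ne_zero (Finite.injective_iff_bijective.mp hw)) hN hr hW h

/-- **The det twin of the reservoir theorem: `det_n` is not a sum of `t n` ordered set-multilinear
ABPs of polynomial total width, for ANY support function `t`** (along `N = 262144 k⁴`, `q = 16k²`,
`r = 16384 k²`: total width `W` with `W² ≥ 2^k`).  Hence the ordered-count axis cannot distinguish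
`per` from `det`. [cite: ChatterjeeKushSarafShpilka2024, Thm 3 (the method); ArvindRaja2016, §7] -/
theorem detNotSumOrdered_all (t : ℕ → ℕ) : DetNotSumOrdered t := by
  intro c
  by_contra hcon
  push Not at hcon
  -- growth bookkeeping in `k`
  let Nk : ℕ → ℕ := fun k => 262144 * k ^ 4
  let g : ℕ → ℕ := fun k => Nk k ^ c + c
  let f : ℕ → ℕ := fun k => g k * (Nk k + 1) + g k ^ 2
  have hNk : IsPBounded Nk :=
    IsPBounded.mul_holds (IsPBounded.const 262144) (IsPBounded.pow_holds IsPBounded.id 4)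
  have hg : IsPBounded g := IsPBounded.add_holds (IsPBounded.pow_holds hNk c) (IsPBounded.const c)
  have hf : IsPBounded f :=
    IsPBounded.add_holds (IsPBounded.mul_holds hg (IsPBounded.add_holds hNk (IsPBounded.const 1)))
      (IsPBounded.pow_holds hg 2)
  obtain ⟨k, hk, hfk⟩ := exists_lt_two_pow_of_isPBounded hf
  -- the parameters
  have hN : 131072 * k ^ 4 + 131072 * k ^ 4 = (16 * k ^ 2) * (16384 * k ^ 2) := by ring
  have hNk' : Nk k = 131072 * k ^ 4 + 131072 * k ^ 4 := by simp only [Nk]; ring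
  have hr : 1024 ≤ 16384 * k ^ 2 := by nlinarith
  have hkq : k ≤ 16 * k ^ 2 := by nlinarith
  have hW : g k * (131072 * k ^ 4 + 131072 * k ^ 4 + 1) < 2 ^ (16 * k ^ 2) := by
    rw [← hNk']
    calc g k * (Nk k + 1) ≤ f k := Nat.le_add_right _ _
      _ < 2 ^ k := hfk
      _ ≤ 2 ^ (16 * k ^ 2) := Nat.pow_le_pow_right (by norm_num) hkq
  have hS : IsSumOrderedDet ℂ (131072 * k ^ 4 + 131072 * k ^ 4) (t (Nk k)) (g k) := by
    have := hcon (Nk k)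
    rw [hNk'] at this
    simpa only [g, hNk'] using this
  have hmain := two_pow_le_pow_of_isSumOrderedDet hN hr hW hS
  -- evaluate the exponent: `⌊√(16384 k²)⌋ = 128 k`, `16k² · 4k / 4 = 16 k³`
  have hsqrt : Nat.sqrt (16384 * k ^ 2) = 128 * k := by
    rw [show 16384 * k ^ 2 = (128 * k) * (128 * k) by ring, Nat.sqrt_eq]
  have hexp : 16 * k ^ 2 * (Nat.sqrt (16384 * k ^ 2) / 32) / 4 = k * (16 * k ^ 2) := by
    rw [hsqrt, show 128 * k = 32 * (4 * k) by ring, Nat.mul_div_cancel_left _ (by norm_num : 0 < 32),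
      show 16 * k ^ 2 * (4 * k) = 4 * (k * (16 * k ^ 2)) by ring,
      Nat.mul_div_cancel_left _ (by norm_num : 0 < 4)]
  rw [hexp] at hmain
  -- `2^{k · 16k²} ≤ W^{16k²+1} ≤ (W²)^{16k²}` forces `2^k ≤ W²`, contradicting `W² < 2^k`
  have hW1 : 1 ≤ g k := by
    have hpos : 0 < Nk k := by simp only [Nk]; positivity
    calc 1 ≤ Nk k ^ c := Nat.one_le_pow _ _ hpos
      _ ≤ g k := Nat.le_add_right _ _
  have hq0 : 16 * k ^ 2 ≠ 0 := by positivity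
  have hle : g k ^ (16 * k ^ 2 + 1) ≤ (g k ^ 2) ^ (16 * k ^ 2) := by
    rw [← pow_mul]
    exact Nat.pow_le_pow_right hW1 (by nlinarith)
  have h2k : 2 ^ k ≤ g k ^ 2 := by
    rw [← Nat.pow_le_pow_iff_left hq0, ← pow_mul]
    exact hmain.trans hle
  have hlt : g k ^ 2 < 2 ^ k := lt_of_le_of_lt (Nat.le_add_left _ _) hfk
  exact absurd (h2k.trans_lt hlt) (lt_irrefl _)

/-- **Per and det alike on this axis**: both dials hold for every support function.
[cite: ArvindRaja2016, §7 (Remark 11); ChatterjeeKushSarafShpilka2024, Thm 3] -/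
theorem perNotSumOrdered_and_detNotSumOrdered (t : ℕ → ℕ) :
    PerNotSumOrdered t ∧ DetNotSumOrdered t :=
  ⟨perNotSumOrdered_all' t, detNotSumOrdered_all t⟩

end Summit.ValiantsHypothesis.ValiantsHypothesis.Theorems.OrderedCountWindow
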